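import Mathlib
import Summits.Ventures.HodgeRepro.Tier4.Common.FundamentalDomainSaturation
import Summits.Ventures.HodgeRepro.Tier4.Line4.CentreFinDomain
import Summits.Ventures.HodgeRepro.Tier4.Line4.ZDomainSplit

/-!
# Tier4/Line4/AwayDomain — the (E1) EXISTENCE half `hDA`: a measurable fundamental domain `DZ^{(S)}` for the image of
the rational centre in the away torus `T_f^{(S)}`, and the product domain `T_S × DZ^{(S)}` of record

Blind re-derivation cell `pub-hodge-repro`, Tier 4 «prove the step» (README §9–§10), seat t4-L2-p2 (gen 5; plan-4 g6's
plate S15757/S15767 «(i) the (E1) existence half `hDA`»).  Tree path `lean/Summits/Ventures/HodgeRepro/Tier4/Line4/AwayDomain.lean`.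
Imports typer-2's `Common/FundamentalDomainSaturation` (`exists_fundamentalDomain_of_discrete_of_central_cocompact`),
this seat's `Line4/CentreFinDomain` (`centreFin`, `ZfIn`, `centreFin_comm`, `t2Space_torusFin`, the displayed clause `hZc`
of ZDOMAIN-EX) and L2-p1's `Line4/ZDomainSplit` (`awayTfHom`, `centreAway`, `isFundamentalDomain_preimage_prod_univ`,
`eq_one_of_mem_centreFin_of_awayTf_placesAbove_eq_one`; through it `Line4/TorusFinSplit`: `torusFinAway`, `awayTf`,
`torusFinSplit`).  One definition (`ZfAway`, the away part of `Z_f`); no literature.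

WHAT IS PROVED.
* `ZfAway W S := Z_f ∩ T_f^{(S)}` (the away part of the finite centre, inside `T_f^{(S)}`); `awayTf_coe` (`awayTf` fixes the
  away torus); `centreAway_le_center` (`centreAway` is central in `T_f^{(S)}`: `z` is central in `T_f`, `awayTf` is a
  homomorphism fixing `T_f^{(S)}`); `ZfAway_subset_centreAway_mul_image` (the cocompactness clause of ZDOMAIN-EX, `Z_f ⊆
  Z(k)·E`, pushes forward to `Z_f^{(S)} ⊆ centreAway · awayTf '' E`).
* **`exists_isFundamentalDomain_centreAway`** (`hDA`, the existence half of (E1)): under the DISCRETENESS of `centreAway W S`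
  (L1-p2's C-L4-NONSPLIT-FINITE `discreteTopology_centreAway_of_nonsplit` at the split `S = placesAbove p`, `p` non-split —
  displayed here as `hdisc`) and ZDOMAIN-EX's clause `hZc` (verbatim from `exists_isFundamentalDomain_centreFin`), a
  measurable `DA ⊆ T_f^{(S)}` with `IsFundamentalDomain (centreAway W S) DA νA`, containing a neighbourhood of `1`, with
  `closure (DA ∩ C·Z_f^{(S)})` compact for every compact `C` — typer-2's cover construction at `G := T_f^{(S)}`,
  `Γ := centreAway W S`, `Z := ZfAway W S`.
* **`exists_isFundamentalDomain_prod_univ`**: the same `DA` together with the PRODUCT DOMAIN of record,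
  `DZ_f := torusFinSplit⁻¹(univ ×ˢ DA)` — measurable and a fundamental domain for `centreFin W` in `T_f` (L2-p1's
  `isFundamentalDomain_preimage_prod_univ` with `hinj` from `eq_one_of_mem_centreFin_of_awayTf_placesAbove_eq_one` at
  `S = placesAbove p`, `p` prime): the `hDZf` / `hfd` binders of x2's glue at `DZS := univ`.
* **C-L4-PRODDOMAIN-HDZC** (plan-4 S15779): `offPlacesPart_mem_centre` (the away part of a central element is central),
  `awayTf_mem_ZfAway`, `isCompact_closure_preimage_prod_univ_inter_mul` (`DZ_f ∩ C·Z_f ⊆ T_S · (DA ∩ awayTf '' C · Z_f^{(S)})`,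
  compact when `T_S` is), and **`exists_isFundamentalDomain_prod_univ_of_compactSpace_at`**: the product domain of record
  WITH ZDOMAIN-EX (iv) `∀ C compact, IsCompact (closure (DZ_f ∩ C·Z_f))`, under the one more displayed binder
  `hTS : CompactSpace (torusFinAt W (placesAbove p))` (the non-split compactness, L1-p2's `compactSpace_torusFinAt_of_nonsplit`).

Nothing here says anything about the status of the Hodge conjecture for CM abelian varieties, which is NOT proved
(HC_CM is NOT proved by anyone in this repository).
-/

set_option autoImplicit false

noncomputable section

namespace Summit.Ventures.HodgeRepro.Tier4.Line4

open Summit.Ventures.HodgeRepro.Tier4 Summit.Ventures.HodgeRepro.Tier4.Common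
  Summit.Ventures.HodgeRepro.Tier4.Line1 NumberField IsDedekindDomain MeasureTheory
open scoped NumberField NNReal ENNReal Pointwise Topology

section Away

variable {k : Type} [Field k] [NumberField k] (W : PlaneData k) (S : Set (HeightOneSpectrum (𝓞 k)))

/-- **The away part of the finite centre** `Z_f^{(S)} = Z_f ∩ T_f^{(S)}`, inside `T_f^{(S)}`. -/
def ZfAway : Subgroup (torusFinAway W S) := (ZfIn W).subgroupOf (torusFinAway W S)

/-- Membership in `ZfAway`. -/
theorem mem_ZfAway (y : torusFinAway W S) : y ∈ ZfAway W S ↔ (y : torusFin W) ∈ ZfIn W := Iff.rfl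

/-- `T_f^{(S)}` is Hausdorff. -/
theorem t2Space_torusFinAway : T2Space (torusFinAway W S) :=
  haveI : T2Space (torusFin W) := t2Space_torusFin W
  inferInstance

/-- `awayTf` fixes the away torus: `awayTf y = y` for `y ∈ T_f^{(S)}` (the split's right inverse at `(1, y)`). -/
theorem awayTf_coe (y : torusFinAway W S) : awayTf W S (y : torusFin W) = y := by
  have h := (torusFinSplit W S).apply_symm_apply ((1 : torusFinAt W S), y)
  rw [torusFinSplit_symm_apply, OneMemClass.coe_one, one_mul, torusFinSplit_apply] at h
  exact (Prod.ext_iff.1 h).2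

/-- `awayTfHom` fixes the away torus. -/
theorem awayTfHom_coe (y : torusFinAway W S) : awayTfHom W S (y : torusFin W) = y := by
  rw [awayTfHom_apply, awayTf_coe]

/-- **`centreAway` is central in `T_f^{(S)}`**: the image of a central element of `T_f` under the homomorphism `awayTf`,
which fixes `T_f^{(S)}`. -/
theorem centreAway_le_center : centreAway W S ≤ Subgroup.center (torusFinAway W S) := by
  rintro _ ⟨z, hz, rfl⟩
  rw [Subgroup.mem_center_iff]
  intro y
  apply Subtype.ext
  rw [Subgroup.coe_mul, Subgroup.coe_mul]
  calc (y : torusFin W) * (awayTfHom W S z : torusFin W)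
      = (awayTfHom W S ((y : torusFin W) * z) : torusFin W) := by rw [map_mul, awayTfHom_coe, Subgroup.coe_mul]
    _ = (awayTfHom W S (z * (y : torusFin W)) : torusFin W) := by rw [centreFin_comm W hz]
    _ = (awayTfHom W S z : torusFin W) * (y : torusFin W) := by rw [map_mul, awayTfHom_coe, Subgroup.coe_mul]

/-- **The cocompactness clause pushes forward to the away torus**: from `Z_f ⊆ Z(k)·E` (`E` compact), `Z_f^{(S)} ⊆
centreAway · awayTf '' E` (`awayTf '' E` compact). -/
theorem ZfAway_subset_centreAway_mul_image {E : Set (torusFin W)}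
    (hZE : (ZfIn W : Set (torusFin W)) ⊆ (centreFin W : Set (torusFin W)) * E) :
    (ZfAway W S : Set (torusFinAway W S)) ⊆ (centreAway W S : Set (torusFinAway W S)) * (awayTf W S '' E) := by
  intro y hy
  obtain ⟨ζ, hζ, e, he, hye⟩ := hZE hy
  have hye' : ζ * e = (y : torusFin W) := hye
  refine ⟨awayTfHom W S ζ, ⟨ζ, hζ, rfl⟩, awayTf W S e, ⟨e, he, rfl⟩, ?_⟩
  show awayTfHom W S ζ * awayTf W S e = y
  rw [← awayTfHom_apply, ← map_mul, hye', awayTfHom_coe]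

/-- **`hDA` — the (E1) existence half**: under the discreteness of `centreAway W S` and ZDOMAIN-EX's cocompactness clause
`hZc`, there is a measurable fundamental domain `DA` for `centreAway W S` in `T_f^{(S)}` (for `ν^{(S)}`), containing a
neighbourhood of `1`, and relatively compact on `Z_f^{(S)}`-saturations of compacts.  typer-2's
`exists_fundamentalDomain_of_discrete_of_central_cocompact` at `G := T_f^{(S)}`, `Γ := centreAway W S`, `Z := ZfAway W S`. -/
theorem exists_isFundamentalDomain_centreAway [MeasurableSpace (torusT W)] [BorelSpace (torusT W)]
    (νA : Measure (torusFinAway W S)) [νA.IsHaarMeasure] (hdisc : DiscreteTopology (centreAway W S))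
    (hZc : ∃ E : Set (torusFin W), IsCompact E ∧ E ⊆ (ZfIn W : Set (torusFin W)) ∧
      (ZfIn W : Set (torusFin W)) ⊆ (centreFin W : Set (torusFin W)) * E) :
    ∃ DA : Set (torusFinAway W S), MeasurableSet DA ∧ IsFundamentalDomain (centreAway W S) DA νA ∧
      (∃ U ∈ 𝓝 (1 : torusFinAway W S), U ⊆ DA) ∧
      ∀ C : Set (torusFinAway W S), IsCompact C →
        IsCompact (closure (DA ∩ (C * (ZfAway W S : Set (torusFinAway W S))))) := by
  haveI : T2Space (torusFinAway W S) := t2Space_torusFinAway W S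
  haveI : LocallyCompactSpace (torusFinAway W S) := locallyCompact_torusFinAway W S
  haveI : SecondCountableTopology (torusFinAway W S) := secondCountable_torusFinAway W S
  haveI : BorelSpace (torusFin W) := Subtype.borelSpace _
  haveI : BorelSpace (torusFinAway W S) := Subtype.borelSpace _
  obtain ⟨E, hEc, -, hZE⟩ := hZc
  exact Common.exists_fundamentalDomain_of_discrete_of_central_cocompact (centreAway W S) νA (ZfAway W S)
    (centreAway_le_center W S) ⟨awayTf W S '' E, hEc.image (continuous_awayTf W S),
      ZfAway_subset_centreAway_mul_image W S hZE⟩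

/-- The product set `T_S × DA`, pulled back along the split, is measurable when `DA` is. -/
theorem measurableSet_preimage_prod_univ [MeasurableSpace (torusT W)] [BorelSpace (torusT W)]
    {DA : Set (torusFinAway W S)} (hDA : MeasurableSet DA) :
    MeasurableSet ((torusFinSplit W S) ⁻¹' (Set.univ ×ˢ DA)) := by
  haveI : BorelSpace (torusFin W) := Subtype.borelSpace _
  haveI : BorelSpace (torusFinAway W S) := Subtype.borelSpace _
  rw [preimage_prod_univ_eq]
  exact hDA.preimage (continuous_awayTfHom W S).measurable

/-- **The product domain of record (E1, `DZS := univ`)**: at the split `S = placesAbove p` (`p` prime), under the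
discreteness of `centreAway` and `hZc`, there is a measurable fundamental domain `DA` for `centreAway` in `T_f^{(p)}`
(relatively compact on `Z_f^{(p)}`-saturations of compacts) such that `DZ_f := torusFinSplit⁻¹(univ ×ˢ DA)` is a
measurable fundamental domain for `centreFin W` in `T_f` (for `ν_f = c • (ν_S ⊗ ν^{(S)})`) — the `hDZf` / `hfd` binders of
the (7b) glue in the product form. -/
theorem exists_isFundamentalDomain_prod_univ [MeasurableSpace (torusT W)] [BorelSpace (torusT W)]
    (νf : Measure (torusFin W)) [νf.IsHaarMeasure] {p : ℕ} (hp : p.Prime)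
    (νS : Measure (torusFinAt W (placesAbove (k := k) p))) [νS.IsHaarMeasure]
    (νA : Measure (torusFinAway W (placesAbove (k := k) p))) [νA.IsHaarMeasure] (c : ℝ≥0)
    (hc : νf = c • Measure.map (torusFinSplit W (placesAbove (k := k) p)).symm (νS.prod νA))
    (hdisc : DiscreteTopology (centreAway W (placesAbove (k := k) p)))
    (hZc : ∃ E : Set (torusFin W), IsCompact E ∧ E ⊆ (ZfIn W : Set (torusFin W)) ∧
      (ZfIn W : Set (torusFin W)) ⊆ (centreFin W : Set (torusFin W)) * E) :
    ∃ DA : Set (torusFinAway W (placesAbove (k := k) p)), MeasurableSet DA ∧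
      IsFundamentalDomain (centreAway W (placesAbove (k := k) p)) DA νA ∧
      (∀ C : Set (torusFinAway W (placesAbove (k := k) p)), IsCompact C →
        IsCompact (closure (DA ∩ (C * (ZfAway W (placesAbove (k := k) p) : Set _))))) ∧
      MeasurableSet ((torusFinSplit W (placesAbove (k := k) p)) ⁻¹' (Set.univ ×ˢ DA)) ∧
      IsFundamentalDomain (centreFin W) ((torusFinSplit W (placesAbove (k := k) p)) ⁻¹' (Set.univ ×ˢ DA)) νf := by
  obtain ⟨DA, hDAm, hDA, -, hDAc⟩ := exists_isFundamentalDomain_centreAway W _ νA hdisc hZc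
  exact ⟨DA, hDAm, hDA, hDAc, measurableSet_preimage_prod_univ W _ hDAm,
    isFundamentalDomain_preimage_prod_univ W _ νf νS νA c hc DA hDA
      (fun z hz h => eq_one_of_mem_centreFin_of_awayTf_placesAbove_eq_one W hp hz h)⟩


/-! ## The `hDZc` clause of the product domain (under the compactness of `T_S`) -/

/-- **The away part of a central element is central** (the twin of the `S`-part statement: components off `S` are those
of `z`, components on `S` and at infinity are `1`). -/
theorem offPlacesPart_mem_centre {z : GA W} (hz : z ∈ centre W) : GA.offPlacesPart W S z ∈ centre W := by
  refine ⟨⟨offPlacesPart_mem_torusT W S hz.1.1, offPlacesPart_mem_torusT' W S hz.1.2⟩, ?_⟩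
  show GA.offPlacesPart W S z ∈ Subgroup.center (GA W)
  rw [Subgroup.mem_center_iff]
  intro h
  have hzc : ∀ h' : GA W, h' * z = z * h' := fun h' => Subgroup.mem_center_iff.1 hz.2 h'
  have hinf : ∀ w : InfinitePlace k, GA.infiniteComponent W w (GA.offPlacesPart W S z) = 1 :=
    (mem_finitePart W _).1 (offPlacesPart_mem_finitePart W S z)
  apply GA.ext_of_components
  · intro w
    rw [map_mul, map_mul, hinf w, one_mul, mul_one]
  · intro w
    by_cases hw : w ∈ S
    · rw [map_mul, map_mul, finiteComponent_offPlacesPart_of_mem W S hw, one_mul, mul_one]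
    · rw [map_mul, map_mul, finiteComponent_offPlacesPart_of_notMem W S hw]
      have := congrArg (GA.finiteComponent W w) (hzc h)
      rw [map_mul, map_mul] at this
      exact this

/-- `awayTf` maps `Z_f` into `Z_f^{(S)}`. -/
theorem awayTf_mem_ZfAway {z : torusFin W} (hz : z ∈ ZfIn W) : awayTf W S z ∈ ZfAway W S := by
  show (((awayTf W S z : torusFin W) : torusT W) : GA W) ∈ centre W
  rw [coe_awayTf]
  exact offPlacesPart_mem_centre W S hz

/-- **The product domain is relatively compact on `Z_f`-saturations of compacts** when `T_S` is compact and `DA` is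
relatively compact on `Z_f^{(S)}`-saturations of compacts: `DZ_f ∩ C·Z_f ⊆ T_S · (DA ∩ awayTf '' C · Z_f^{(S)})`. -/
theorem isCompact_closure_preimage_prod_univ_inter_mul (hTS : IsCompact (torusFinAt W S : Set (torusFin W)))
    {DA : Set (torusFinAway W S)}
    (hDAc : ∀ C : Set (torusFinAway W S), IsCompact C →
      IsCompact (closure (DA ∩ (C * (ZfAway W S : Set (torusFinAway W S))))))
    {C : Set (torusFin W)} (hC : IsCompact C) :
    IsCompact (closure (((torusFinSplit W S) ⁻¹' (Set.univ ×ˢ DA)) ∩ (C * (ZfIn W : Set (torusFin W))))) := by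
  haveI : T2Space (torusFin W) := t2Space_torusFin W
  have hLc : IsCompact (closure (DA ∩ ((awayTf W S '' C) * (ZfAway W S : Set (torusFinAway W S))))) :=
    hDAc _ (hC.image (continuous_awayTf W S))
  have hK : IsCompact ((torusFinAt W S : Set (torusFin W)) *
      (Subtype.val '' closure (DA ∩ ((awayTf W S '' C) * (ZfAway W S : Set (torusFinAway W S)))))) :=
    hTS.mul (hLc.image continuous_subtype_val)
  refine hK.closure_of_subset ?_
  rintro b ⟨hbD, hbC⟩
  obtain ⟨c, hc, z, hz, rfl⟩ := hbC
  have hbD' : awayTf W S (c * z) ∈ DA := by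
    have h : torusFinSplit W S (c * z) ∈ Set.univ ×ˢ DA := hbD
    rw [torusFinSplit_apply] at h
    exact h.2
  have hsplit : (atTf W S (c * z) : torusFin W) * (awayTf W S (c * z) : torusFin W) = c * z := by
    have h := (torusFinSplit W S).symm_apply_apply (c * z)
    rwa [torusFinSplit_apply, torusFinSplit_symm_apply] at h
  refine ⟨atTf W S (c * z), (atTf W S (c * z)).2, (awayTf W S (c * z) : torusFin W),
    ⟨awayTf W S (c * z), subset_closure ⟨hbD', ?_⟩, rfl⟩, hsplit⟩
  rw [← awayTfHom_apply, map_mul]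
  exact ⟨awayTfHom W S c, ⟨c, hc, rfl⟩, awayTfHom W S z, awayTf_mem_ZfAway W S hz, rfl⟩

/-- **C-L4-PRODDOMAIN-HDZC — the product domain of record WITH its `hDZc` clause** (plan-4 S15779): under the
compactness of the `S`-torus `T_S` at the non-split places (`hTS`, L1-p2's `compactSpace_torusFinAt_of_nonsplit`), `DA`
and `DZ_f := torusFinSplit⁻¹(univ ×ˢ DA)` as in `exists_isFundamentalDomain_prod_univ`, plus ZDOMAIN-EX (iv) for `DZ_f` —
the `hDZc` binder of `suppMeasure_ne_top` (RatioGlue's `hfin`, TailGlueMain's `hv`). -/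
theorem exists_isFundamentalDomain_prod_univ_of_compactSpace_at [MeasurableSpace (torusT W)]
    [BorelSpace (torusT W)] (νf : Measure (torusFin W)) [νf.IsHaarMeasure] {p : ℕ} (hp : p.Prime)
    (νS : Measure (torusFinAt W (placesAbove (k := k) p))) [νS.IsHaarMeasure]
    (νA : Measure (torusFinAway W (placesAbove (k := k) p))) [νA.IsHaarMeasure] (c : ℝ≥0)
    (hc : νf = c • Measure.map (torusFinSplit W (placesAbove (k := k) p)).symm (νS.prod νA))
    (hdisc : DiscreteTopology (centreAway W (placesAbove (k := k) p)))
    (hZc : ∃ E : Set (torusFin W), IsCompact E ∧ E ⊆ (ZfIn W : Set (torusFin W)) ∧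
      (ZfIn W : Set (torusFin W)) ⊆ (centreFin W : Set (torusFin W)) * E)
    (hTS : CompactSpace (torusFinAt W (placesAbove (k := k) p))) :
    ∃ DA : Set (torusFinAway W (placesAbove (k := k) p)), MeasurableSet DA ∧
      IsFundamentalDomain (centreAway W (placesAbove (k := k) p)) DA νA ∧
      MeasurableSet ((torusFinSplit W (placesAbove (k := k) p)) ⁻¹' (Set.univ ×ˢ DA)) ∧
      IsFundamentalDomain (centreFin W) ((torusFinSplit W (placesAbove (k := k) p)) ⁻¹' (Set.univ ×ˢ DA)) νf ∧
      ∀ C : Set (torusFin W), IsCompact C →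
        IsCompact (closure (((torusFinSplit W (placesAbove (k := k) p)) ⁻¹' (Set.univ ×ˢ DA)) ∩
          (C * (ZfIn W : Set (torusFin W))))) := by
  obtain ⟨DA, hDAm, hDA, hDAc, hDZm, hDZ⟩ := exists_isFundamentalDomain_prod_univ W νf hp νS νA c hc hdisc hZc
  have hTS' : IsCompact (torusFinAt W (placesAbove (k := k) p) : Set (torusFin W)) :=
    isCompact_iff_compactSpace.2 hTS
  exact ⟨DA, hDAm, hDA, hDZm, hDZ, fun C hC =>
    isCompact_closure_preimage_prod_univ_inter_mul W _ hTS' hDAc hC⟩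

end Away

end Summit.Ventures.HodgeRepro.Tier4.Line4

end
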